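import Summits.QuantumFields.BalabanUV.T4Continuum.Support.NE3DecomposedRepOfLinearNormalPart
import Summits.QuantumFields.BalabanUV.T4Continuum.Support.NE3LinearNormalPartPreSizes
import Summits.QuantumFields.BalabanUV.T4Continuum.Support.NE3ProductPathPlaquettes
import HarnessLib

/-!
# T⁴ programme, node NE3 — route Π, file 4γ (ruling ρ-g26-1 (3)): THE CURRENCY-AGNOSTIC JUNCTION — `DecomposedRep` FROM THE R-ADAPTED RESIDUAL
# SLICE REPRESENTATIVE, A SQUARE-SUMMABLE WEIGHT AND THE LOCAL QUADRATIC LETTER OF THE LINEARISED AVERAGE, plus the letters of the linear normal part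

NE3 (node U1b), row NE3 OWNER `b2b-balaban-t4-ne3-p1` (gen 26); ruling ρ-g26-1 (journal l.24615) after the disprover's FINDING D-ne3r2-g12-1 (l.24400): the
sup-currency majorant (Π-REG) `LocalSupMajorant[Ball]` cannot carry a j-uniform constant for the residual slice representative of a pair (corner Coulomb spikes
of the pinned Landau gauge), so the junction of record must not fix the currency in which the quadratic remainder of the linearised average is measured.  This
file is file 4 (`NE3DecomposedRepOfShapes.decomposedRep_of_shapes`, p242094) MINUS its step (1): the local quadratic bound `hφ` of `dirIter L (j+1) W X₀` against a
square-summable weight `m` is a HYPOTHESIS (supplier of record: Π-C-3γ in the PATH-SUM currency over the leaf (Π-REG-γ), leaf-02 lineage, ruling (2)); in exchange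
NO multi-level smallness, NO curvature-sum line, NO fibre equation and NO periodicity of the background appear.
Inputs BY NAME: file 2 `NE3DecomposedRepOfLinearNormalPart.decomposedRep_of_linearNormalPart` (+ shape `ResidualSliceRepT`), file 3a
`NE3LinearNormalPartPreSizes.preSizes_of_letters`, leaf-04-g7's 3b `NE3ProductPathPlaquettes.small_of_residual_data_poly`, file 1 `NE3ResidualSliceRep`
(`normalPart`, `norm_normalPart_sub_le`, `normalPart_skew`).

WHAT.  **`decomposedRep_of_quadLetter`**: at a pair `(U_A, U_B)` of level `j+1` with unitary background `W = cavg L U_B` admissible for run A, given an R-ADAPTED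
RESIDUAL SLICE REPRESENTATIVE `(u, X₀, Nn, α₀)` [leaf Π-L1♮], a WEIGHT `m ≥ 0` with `(L^{j+1})^d Σ_{z,κ} m² ≤ C²·dirSq X₀` and a ceiling `αm` (`m ≤ αm`,
`α₀ ≤ αm ≤ 1∕100`), THE LOCAL QUADRATIC LETTER `‖dirIter L (j+1) W X₀ z κ‖ ≤ C₂·((L^{j+1})·m z κ)²` on the coarse period box, a linear normal part `Nn` (MEANT:
`R_W(D_W X₀)`) with letters (R1)–(R4) against `φ := dirIter L (j+1) W X₀`, sup `αN`, window sup-curl `aN`, window radii `xW`, `xA`, and two numeric lines —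
`DecomposedRep 𝒞 L N (j+1) V U_A U_B u X N α αN′ ν κ₁ κ₂ a` with `X = Nn − X₀`, `N = log(e^{X₀}e^{X})`, EVERY letter displayed:
`ν = (1+2048√(16d+1))·2√(c₁+c₂)·C₂·C·(αm·L^{j+1})`, `κ₁ = 4c₃C₂C²(aM²) + 8192d·4c₄C₂C²(aM²)`, `κ₂ = 1806·4c₄C₂C²(aM²)`, `a = 2xW + xA + 2aN + …`.

HONEST FRAMING.  Bookkeeping over landed kernel theorems; the representative, the weight, the quadratic letter, the letters of `Nn`, the window radii and the numeric
lines are HYPOTHESES; (P♮)_W's numeric lines, (H∃), T-E_w♯ and NE3 are NOT proved; spine PROVED 0∕9; finite T⁴ rung (B)+1 — NOT infinite volume, NOT mass gap, NOT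
`BetaPertH`, NOT Clay.  PLACEMENT: `Summits/QuantumFields/BalabanUV/`.  HONEST DEPENDENCY: continuum YM on T⁴ ⇐ BetaPertH ∧ nine spine estimates (0/9 proved);
BetaPertH ⇐ (D1) ∧ (D4) ∧ CAP+tail; G-an2-4 gates asym, D1 and NE2/3/4.
-/

set_option autoImplicit false

open scoped BigOperators Matrix.Norms.L2Operator
open NormedSpace Finset

namespace Summit.QuantumFields.BalabanUV.T4Continuum.NE3DecomposedRepOfQuadLetter

open Set
open Literature.MathematicalPhysics.QuantumFieldTheory.Balaban1983to89
open B7Prop1Explicit B7Prop2Explicit MatrixLog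
open T4AveragingDeficitWall (IsSkewDir IsUnitaryCfg vary curl curlSq dirSq dirL1 fhol)
open T4AveragingDeficitWallBoundary (periodBox)
open AveragingDeficitPeriodicCounting (IsPeriodicDir)
open AveragingDeficitChartCalculus (cavg)
open AveragingDeficitDerivCore (dirL1_nonneg)
open MinimalActionLevels (perWin)
open MinimalActionSandwich (admissible)
open NE3TangentCovariantTower (dirIter)
open NE3EnergyWeightedShapes (energyNormW energyNormW_nonneg)
open NE3EnergyRateWSupOfSlicePoincare (mem_frameFreeBlockLandauW_struct)
open NE3ProductPath (pathΓ)
open NE3ProductPathChart (DecomposedRep)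
open NE3ProductPathPlaquettes (small_of_residual_data_poly)
open NE3ResidualSliceRep (normalPart norm_normalPart_sub_le normalPart_skew)
open NE3DecomposedRepOfLinearNormalPart (ResidualSliceRepT decomposedRep_of_linearNormalPart)
open NE3LinearNormalPartPreSizes (preSizes_of_letters)

noncomputable section

variable {d : ℕ} {n : Type*} [Fintype n] [DecidableEq n]

/-- **`DecomposedRep` FROM THE RESIDUAL SLICE REPRESENTATIVE, A SQUARE-SUMMABLE WEIGHT AND THE LOCAL QUADRATIC LETTER** (currency-agnostic junction of
route Π).  See the module docstring; all letters displayed. [folklore] -/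
theorem decomposedRep_of_quadLetter [Nonempty n] {𝒞 : ℕ → _root_.Set (Site d → Fin d → (Matrix n n ℂ)ˣ)} {L N : ℕ}
    (hL : 1 ≤ L) (hN : 1 ≤ N) (j : ℕ) {V UA UB : Site d → Fin d → (Matrix n n ℂ)ˣ}
    (hWu : IsUnitaryCfg (cavg L UB)) (admW : cavg L UB ∈ admissible 𝒞 L (j + 1) V)
    -- the R-adapted residual slice representative [leaf]
    {u : Site d → (Matrix n n ℂ)ˣ} {X₀ Nn : Site d → Fin d → Matrix n n ℂ} {α₀ : ℝ}
    (h : ResidualSliceRepT L N (j + 1) (cavg L UB) UA u X₀ Nn α₀)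
    -- the square-summable weight, its ceiling, and the local quadratic letter of the linearised average of `X₀`
    {m : Site d → Fin d → ℝ} {C C₂ αm : ℝ} (hm0 : ∀ z κ, 0 ≤ m z κ) (hC : 0 ≤ C) (hC₂ : 0 ≤ C₂)
    (hsq : ((L : ℝ) ^ (j + 1)) ^ d * ∑ z ∈ periodBox (d := d) N, ∑ κ : Fin d, m z κ ^ 2
      ≤ C ^ 2 * dirSq X₀ (periodBox (d := d) (N * L ^ (j + 1))))
    (hmα : ∀ z κ, m z κ ≤ αm) (hα₀m : α₀ ≤ αm) (hαm : αm ≤ 1 / 100)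
    (hφ : ∀ z ∈ periodBox (d := d) N, ∀ κ : Fin d,
      ‖dirIter L (j + 1) (cavg L UB) X₀ z κ‖ ≤ C₂ * ((L : ℝ) ^ (j + 1) * m z κ) ^ 2)
    -- the linear normal part and its letters against `φ := dirIter L (j+1) W X₀`
    {αN aN c₁ c₂ c₃ c₄ : ℝ} (hNP : IsPeriodicDir Nn ((N * L ^ (j + 1) : ℕ) : ℤ)) (hαN0 : 0 ≤ αN) (hNsup : ∀ y μ, ‖Nn y μ‖ ≤ αN)
    (hαN : αN ≤ 1 / 2700) (hJ1 : (αm + 43 * αN) * (L : ℝ) ^ (j + 1) ≤ 1)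
    (haN : ∀ p ∈ perWin d (N * L ^ (j + 1)), ‖curl (cavg L UB) Nn p‖ ≤ aN) (haN0 : 0 ≤ aN)
    (hc₁ : 0 ≤ c₁) (hc₂ : 0 ≤ c₂) (hc₃ : 0 ≤ c₃) (hc₄ : 0 ≤ c₄)
    (hR1 : dirSq Nn (periodBox (d := d) (N * L ^ (j + 1)))
      ≤ c₁ * (((L : ℝ) ^ (j + 1)) ^ d / ((L : ℝ) ^ (j + 1)) ^ 2) * dirSq (dirIter L (j + 1) (cavg L UB) X₀) (periodBox (d := d) N))
    (hR2 : curlSq (cavg L UB) Nn (periodBox (d := d) (N * L ^ (j + 1)))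
      ≤ c₂ * (((L : ℝ) ^ (j + 1)) ^ d / ((L : ℝ) ^ (j + 1)) ^ 4) * dirSq (dirIter L (j + 1) (cavg L UB) X₀) (periodBox (d := d) N))
    (hR3 : ∑ p ∈ perWin d (N * L ^ (j + 1)), ‖curl (cavg L UB) Nn p‖
      ≤ c₃ * (((L : ℝ) ^ (j + 1)) ^ d / ((L : ℝ) ^ (j + 1)) ^ 2) * dirL1 (dirIter L (j + 1) (cavg L UB) X₀) (periodBox (d := d) N))
    (hR4 : dirL1 Nn (periodBox (d := d) (N * L ^ (j + 1)))
      ≤ c₄ * (((L : ℝ) ^ (j + 1)) ^ d / (L : ℝ) ^ (j + 1)) * dirL1 (dirIter L (j + 1) (cavg L UB) X₀) (periodBox (d := d) N))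
    -- the smallness of the ν-letter
    (hρ : 2 * (c₁ + c₂) * C₂ ^ 2 * C ^ 2 * (αm * (L : ℝ) ^ (j + 1)) ^ 2 ≤ 1 / 2)
    -- window radii of `W` and of `U_A^u = W·e^{X₀}`
    {xW xA : ℝ} (hxW0 : 0 ≤ xW) (hxA0 : 0 ≤ xA)
    (hxW : ∀ p ∈ perWin d (N * L ^ (j + 1)), ‖((fhol (cavg L UB) p : (Matrix n n ℂ)ˣ) : Matrix n n ℂ) - 1‖ ≤ xW)
    (hxA : ∀ p ∈ perWin d (N * L ^ (j + 1)), ‖((fhol (vary (cavg L UB) X₀ 1) p : (Matrix n n ℂ)ˣ) : Matrix n n ℂ) - 1‖ ≤ xA) :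
    DecomposedRep 𝒞 L N (j + 1) V UA UB u (fun y μ => Nn y μ - X₀ y μ) (normalPart X₀ fun y μ => Nn y μ - X₀ y μ)
      (α₀ + αN) ((1 + 2048 * (α₀ + αN)) * αN)
      ((1 + 2048 * Real.sqrt (16 * d + 1)) * (2 * Real.sqrt (c₁ + c₂) * C₂ * C * (αm * (L : ℝ) ^ (j + 1))))
      (4 * c₃ * C₂ * C ^ 2
          * ((2 * xW + xA + 2 * aN + 4 * (2048 * (α₀ + αN) * αN) + 48 * α₀ ^ 2 + 1300 * ((α₀ + αN) + (1 + 2048 * (α₀ + αN)) * αN) ^ 2)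
            * ((L : ℝ) ^ (j + 1)) ^ 2)
        + 8192 * d * (4 * c₄ * C₂ * C ^ 2
          * ((2 * xW + xA + 2 * aN + 4 * (2048 * (α₀ + αN) * αN) + 48 * α₀ ^ 2 + 1300 * ((α₀ + αN) + (1 + 2048 * (α₀ + αN)) * αN) ^ 2)
            * ((L : ℝ) ^ (j + 1)) ^ 2)))
      (1806 * (4 * c₄ * C₂ * C ^ 2
          * ((2 * xW + xA + 2 * aN + 4 * (2048 * (α₀ + αN) * αN) + 48 * α₀ ^ 2 + 1300 * ((α₀ + αN) + (1 + 2048 * (α₀ + αN)) * αN) ^ 2)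
            * ((L : ℝ) ^ (j + 1)) ^ 2)))
      (2 * xW + xA + 2 * aN + 4 * (2048 * (α₀ + αN) * αN) + 48 * α₀ ^ 2 + 1300 * ((α₀ + αN) + (1 + 2048 * (α₀ + αN)) * αN) ^ 2) := by
  set a : ℝ := 2 * xW + xA + 2 * aN + 4 * (2048 * (α₀ + αN) * αN) + 48 * α₀ ^ 2
    + 1300 * ((α₀ + αN) + (1 + 2048 * (α₀ + αN)) * αN) ^ 2 with hadef
  have hα₀0 : 0 ≤ α₀ := h.hα₀
  have hαm0 : 0 ≤ αm := hα₀0.trans hα₀m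
  have ha0 : 0 ≤ a := by rw [hadef]; positivity
  have hα₀ : α₀ ≤ 1 / 100 := hα₀m.trans hαm
  -- structural data of the tangent datum `X := Nn − X₀`
  obtain ⟨hXs, -, -⟩ := mem_frameFreeBlockLandauW_struct h.tangent
  -- (2) the pre-sizes of `Nn` from the letters, at the ceiling `αm`
  have hsL : (αm + αN) * (L : ℝ) ^ (j + 1) ≤ 1 := by
    have h1 : αm + αN ≤ αm + 43 * αN := by linarith
    exact (mul_le_mul_of_nonneg_right h1 (by positivity)).trans hJ1
  obtain ⟨hN1, hN2, hN3⟩ := preSizes_of_letters (N := N) hL (j + 1) (cavg L UB) (X₀ := X₀) (Nn := Nn)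
    (φ := dirIter L (j + 1) (cavg L UB) X₀) (m := m) (C₂ := C₂) (C := C) (a := a)
    hαm0 hαN0 hC₂ hC hc₁ hc₂ hc₃ hc₄ ha0 hm0 hmα hsq hφ hR1 hR2 hR3 hR4 hρ hsL
  -- the ℓ¹ size at the representative's own sup `α₀ ≤ αm`
  have hN3' : a * ((α₀ + αN) * dirL1 Nn (periodBox (d := d) (N * L ^ (j + 1))))
      ≤ 4 * c₄ * C₂ * C ^ 2 * (a * ((L : ℝ) ^ (j + 1)) ^ 2)
        * energyNormW L (j + 1) (cavg L UB) (fun y μ => Nn y μ - X₀ y μ) (periodBox (d := d) (N * L ^ (j + 1))) ^ 2 := by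
    have hD0 : 0 ≤ dirL1 Nn (periodBox (d := d) (N * L ^ (j + 1))) := dirL1_nonneg _ _
    have h1 : (α₀ + αN) * dirL1 Nn (periodBox (d := d) (N * L ^ (j + 1))) ≤ (αm + αN) * dirL1 Nn (periodBox (d := d) (N * L ^ (j + 1))) :=
      mul_le_mul_of_nonneg_right (by linarith) hD0
    exact (mul_le_mul_of_nonneg_left h1 ha0).trans hN3
  -- (3) the moving plaquette radius from 3b
  have hJ1' : (α₀ + 43 * αN) * (L : ℝ) ^ (j + 1) ≤ 1 := by
    have h1 : α₀ + 43 * αN ≤ αm + 43 * αN := by linarith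
    exact (mul_le_mul_of_nonneg_right h1 (by positivity)).trans hJ1
  have hs32 : α₀ + αN < 1 / 32 := by linarith
  have hXsup : ∀ y μ, ‖Nn y μ - X₀ y μ‖ ≤ α₀ + αN := fun y μ =>
    (norm_sub_le _ _).trans (by rw [add_comm]; exact add_le_add (h.sup y μ) (hNsup y μ))
  have hX32 : ∀ y μ, ‖Nn y μ - X₀ y μ‖ ≤ 1 / 32 := fun y μ => (hXsup y μ).trans hs32.le
  have hX₀32 : ∀ y μ, ‖X₀ y μ‖ ≤ 1 / 32 := fun y μ => (h.sup y μ).trans (by linarith)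
  have hNgs : IsSkewDir (normalPart X₀ fun y μ => Nn y μ - X₀ y μ) := normalPart_skew h.skew hXs hX₀32 hX32
  have hαN32 : αN < 1 / 32 := by linarith
  have hNgsub : ∀ y μ, ‖normalPart X₀ (fun y μ => Nn y μ - X₀ y μ) y μ - Nn y μ‖ ≤ 2048 * (α₀ + αN) * αN := by
    intro y μ
    have hb := norm_normalPart_sub_le (X₀ := X₀) (Nn := Nn) (y := y) (μ := μ) ((hXsup y μ).trans_lt hs32)
      ((hNsup y μ).trans_lt hαN32)
    have h1 : 0 ≤ ‖Nn y μ‖ := norm_nonneg _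
    have hs0 : 0 ≤ α₀ + αN := by positivity
    have h2 : ‖Nn y μ - X₀ y μ‖ * ‖Nn y μ‖ ≤ (α₀ + αN) * αN := mul_le_mul (hXsup y μ) (hNsup y μ) h1 hs0
    have h3 : 2048 * ‖Nn y μ - X₀ y μ‖ * ‖Nn y μ‖ ≤ 2048 * (α₀ + αN) * αN := by
      have := mul_le_mul_of_nonneg_left h2 (by norm_num : (0:ℝ) ≤ 2048)
      linarith [this]
    exact hb.trans h3
  have hNgsup : ∀ y μ, ‖normalPart X₀ (fun y μ => Nn y μ - X₀ y μ) y μ‖ ≤ (1 + 2048 * (α₀ + αN)) * αN := by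
    intro y μ
    calc ‖normalPart X₀ (fun y μ => Nn y μ - X₀ y μ) y μ‖
        = ‖(normalPart X₀ (fun y μ => Nn y μ - X₀ y μ) y μ - Nn y μ) + Nn y μ‖ := by rw [sub_add_cancel]
      _ ≤ ‖normalPart X₀ (fun y μ => Nn y μ - X₀ y μ) y μ - Nn y μ‖ + ‖Nn y μ‖ := norm_add_le _ _
      _ ≤ 2048 * (α₀ + αN) * αN + αN := add_le_add (hNgsub y μ) (hNsup y μ)
      _ = (1 + 2048 * (α₀ + αN)) * αN := by ring
  have h42 : 1 + 2048 * (α₀ + αN) ≤ 42 := by linarith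
  have hαN' : (1 + 2048 * (α₀ + αN)) * αN ≤ 1 / 64 := by
    have hb : (1 + 2048 * (α₀ + αN)) * αN ≤ 42 * αN := mul_le_mul_of_nonneg_right h42 hαN0
    linarith
  have hsmall : ∀ t ∈ Icc (0:ℝ) 1, ∀ p ∈ perWin d (N * L ^ (j + 1)),
      ‖((fhol (vary (cavg L UB) (pathΓ (fun y μ => Nn y μ - X₀ y μ) (normalPart X₀ fun y μ => Nn y μ - X₀ y μ) t) 1) p
        : (Matrix n n ℂ)ˣ) : Matrix n n ℂ) - 1‖ ≤ a := by
    intro t ht p hp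
    have h3b := small_of_residual_data_poly hWu h.skew hXs hNgs (X₀ := X₀) (Nn := Nn) (fun _ _ => rfl) hNgsub h.sup
      (by linarith) hXsup hNgsup hs32.le hαN' (perWin d (N * L ^ (j + 1))) hxW hxA haN ht p hp
    rw [hadef]; exact h3b
  -- (4) file 2
  exact decomposedRep_of_linearNormalPart hL hN j hWu admW h hα₀ hNP hαN0 hNsup hαN hJ1' ha0 hN1 hN2 hN3' hsmall

end

end Summit.QuantumFields.BalabanUV.T4Continuum.NE3DecomposedRepOfQuadLetter
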